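import Literature.NumberTheory.EllipticCurves.IwasawaSelmerControlLocalInputsProofs
import HarnessLib

/-!
# Route `ByReductionTypeAtTwo`, crux `MultUpperHalfAtTwo` (item stmt-BirchSwinnertonDyer-19922), TOWER road, the
# «ONE BIT AT A NON-SPLIT 2» rows: KERNEL BRICK 11 — the `m`-torsion of the local tower kernel `𝒦_{E,n}[p^∞]` embeds
# into the `m`-torsion of the coinvariants `M_∞/(g − 1)M_∞` (local inflation–restriction, torsion-level count)

HONEST FRAMING (cell `bsd-2adic`, run/shared/lean/pub/bsd-2adic/, seat `bsd-2adic-tower-1` GEN 8, HUMAN RULINGS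
D-0036 / D-0054 / D-0074): TOOL theorems only (no definition, no named fact, no `sorry`); closes nothing by itself;
nothing booked; BSD is not proved by any of this. Step S2 of the KERNELISATION of the displayed MEMO binder
`MultTowerNS2.localTowerKerTwoTorsion_le_two_nonsplitTwo_of_tateUnit` (scope HOME/tower/SCOPE-hNS2one-kernel-GEN8.md): the
tree's `WeierstrassCurve.finite_localTowerKerPrimary_and_card_le` (`IwasawaSelmerControlLocalInputsProofs.lean`; Greenberg,
LNM 1716, §3, proofs of Lemmas 3.3/3.4: "`ker(r_{v_n}) ≅ H¹(Γ_{v_n}, ·) ≅ (·)/(γ_{v_n} − 1)(·)`") bounds the ORDER of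
`𝒦_{E,n}[p^∞]` by that of the `p`-primary part of the coinvariants; the binder hNS2one is a statement about the
`2`-TORSION `𝒦_{v,n}[2]`, so this file records the same inflation–restriction embedding
(`ResKernel.exists_addMonoidHom_subgroupResKer_injective`, an injective additive map `ker res ↪ M^N/(γ−1)M^N`) at the
level of `m`-torsion: for any `g ∈ H_{E,n}` generating `H_{E,n}` topologically together with `H_{E,∞}`
(`ZpExtension.exists_mem_localSubgroup_generate`),

  `#{x ∈ 𝒦_{E,n}[p^∞] : m x = 0} ≤ #{y ∈ M_∞/(g − 1)M_∞ : m y = 0}`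

whenever the right side is finite (`M_∞ = E(K̄_E)^{H_{E,∞}}`). With `m = 2`, `E = ℚ_v`, `v ∋ 2`, this reduces hNS2one to
«the coinvariants `E(ℚ_{2,∞})/(g − 1)` of the twisted Tate module have at most two `2`-torsion classes» (scope S3–S6).

* `finite_torsionBy_localTowerKerPrimary_and_card_le` — the statement (any `K`-field `E`, any `ℤ_p`-extension `κ`, any `m`).

References: R. Greenberg, LNM 1716 (1999), §3 Lemma 3.1 (p. 86), Lemmas 3.3–3.4 (pp. 87–89); J.-P. Serre, *Galois
Cohomology*, I §2.6, XIII §1; scope memo SCOPE-hNS2one-kernel-GEN8.md S2.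
-/

set_option autoImplicit false
-- the Theorems namespace of this sub repeats the summit name by design (D-0017 nested layout: Summit.<S>.<Sub>)
set_option linter.dupNamespace false

noncomputable section

open scoped Classical

universe u

namespace Summit.BirchSwinnertonDyer.BirchSwinnertonDyer.Theorems.MultTowerNS2

open Literature.NumberTheory.EllipticCurves Literature.NumberTheory.GaloisRepresentations
  Literature.NumberTheory.EllipticCurves.ResKernel WeierstrassCurve

variable {K : Type u} [Field K] (W : WeierstrassCurve K) {p : ℕ} [Fact p.Prime] (κ : ZpExtension K p)
  (E : Type u) [Field E] [Algebra K E]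

/-- **Local inflation–restriction at the level of `m`-torsion: `𝒦_{E,n}[p^∞][m] ↪ (M_∞/(g − 1)M_∞)[m]`.** Let
`M_∞ = E(K̄_E)^{H_{E,∞}}` and `g ∈ H_{E,n}` generate `H_{E,n}` topologically together with `H_{E,∞}` (every open subgroup
of `Γ_E` containing both contains `H_{E,n}`; `ZpExtension.exists_mem_localSubgroup_generate`). Then for every `m` the
elements of the `p`-power torsion `𝒦_{E,n}[p^∞]` of the local tower kernel killed by `m` are finitely many, at most as many
as the elements of the coinvariants `M_∞/(g − 1)M_∞` killed by `m`, whenever the latter are finitely many. Proof: the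
tree's injective additive inflation–restriction map `ker res ↪ M^N/(γ − 1)M^N`
(`ResKernel.exists_addMonoidHom_subgroupResKer_injective`) for the topological group `H_{E,n}`, its normal subgroup
`H_{E,∞}` and `g`, transported exactly as in `WeierstrassCurve.finite_localTowerKerPrimary_and_card_le` (whose
`p`-primary count this refines to `m`-torsion). [cite: GreenbergLNM1716, §3 Lemma 3.3 (proof, p. 87)] -/
theorem finite_torsionBy_localTowerKerPrimary_and_card_le (n : ℕ) {g : Field.absoluteGaloisGroup E}
    (hg : g ∈ localSubgroup (κ.layerSubgroup n) E)
    (hgen : ∀ U : Subgroup (Field.absoluteGaloisGroup E),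
      IsOpen (U : Set (Field.absoluteGaloisGroup E)) → localSubgroup κ.kerSubgroup E ≤ U →
        g ∈ U → localSubgroup (κ.layerSubgroup n) E ≤ U) (m : ℕ)
    [Finite {y : FixedPoints.addSubgroup (localSubgroup κ.kerSubgroup E) (localPoints W E) ⧸
        (subOne (localSubgroup κ.kerSubgroup E) (localPoints W E) g).range // m • y = 0}] :
    Finite {x : W.localTowerKerPrimary κ E n // m • x = 0} ∧
      Nat.card {x : W.localTowerKerPrimary κ E n // m • x = 0} ≤
        Nat.card {y : FixedPoints.addSubgroup (localSubgroup κ.kerSubgroup E) (localPoints W E) ⧸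
          (subOne (localSubgroup κ.kerSubgroup E) (localPoints W E) g).range // m • y = 0} := by
  -- notation
  let P : Type u := localPoints W E
  let Hn : Subgroup (Field.absoluteGaloisGroup E) := localSubgroup (κ.layerSubgroup n) E
  let Hi : Subgroup (Field.absoluteGaloisGroup E) := localSubgroup κ.kerSubgroup E
  let N : Subgroup Hn := Hi.subgroupOf Hn
  let γ : Hn := ⟨g, hg⟩
  have hle : Hi ≤ Hn := localSubgroup_ker_le_layer κ E n
  -- (1) `H_{E,∞}` and `g` generate `H_{E,n}` (inside the topological group `H_{E,n}`)
  have hgen' : ∀ U : Subgroup Hn, IsOpen (U : Set Hn) → N ≤ U → γ ∈ U → U = ⊤ := by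
    intro U hU hNU hγU
    let U' : Subgroup (Field.absoluteGaloisGroup E) := U.map Hn.subtype
    have hopen : IsOpen (U' : Set (Field.absoluteGaloisGroup E)) :=
      (isOpen_localSubgroup_layerSubgroup E κ n).isOpenMap_subtype_val _ hU
    have hN' : Hi ≤ U' := fun τ hτ ↦
      ⟨⟨τ, hle hτ⟩, hNU (Subgroup.mem_subgroupOf.mpr hτ), rfl⟩
    have hγU' : g ∈ U' := ⟨γ, hγU, rfl⟩
    have hle' := hgen U' hopen hN' hγU'
    rw [eq_top_iff]
    intro x _
    obtain ⟨u, hu, hux⟩ := hle' x.2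
    have : u = x := Subtype.ext hux
    exact this ▸ hu
  -- (2) orbit maps on `H_{E,n}` are continuous
  have hcont : ∀ m : P, Continuous fun x : Hn ↦ x • m := fun m ↦
    (continuous_smul_localPoints W E m).comp continuous_subtype_val
  -- (3) `P^N = P^{H_{E,∞}} = M_∞`, compatibly with `g - 1`
  have hfix : FixedPoints.addSubgroup N P = FixedPoints.addSubgroup Hi P := by
    ext m
    simp only [FixedPoints.mem_addSubgroup]
    constructor
    · intro h τ
      exact h ⟨⟨τ, hle τ.2⟩, Subgroup.mem_subgroupOf.mpr τ.2⟩
    · intro h x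
      exact h ⟨((x : Hn) : Field.absoluteGaloisGroup E), Subgroup.mem_subgroupOf.mp x.2⟩
  let e : FixedPoints.addSubgroup N P ≃+ FixedPoints.addSubgroup Hi P :=
    AddEquiv.addSubgroupCongr hfix
  have he : AddSubgroup.map (e : FixedPoints.addSubgroup N P →+ FixedPoints.addSubgroup Hi P)
      (subOne N P γ).range = (subOne Hi P g).range := by
    ext b
    constructor
    · rintro ⟨x, ⟨y, rfl⟩, rfl⟩
      exact ⟨e y, Subtype.ext rfl⟩
    · rintro ⟨y, rfl⟩
      exact ⟨subOne N P γ (e.symm y), ⟨e.symm y, rfl⟩, Subtype.ext rfl⟩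
  let eq : FixedPoints.addSubgroup N P ⧸ (subOne N P γ).range ≃+
      FixedPoints.addSubgroup Hi P ⧸ (subOne Hi P g).range :=
    QuotientAddGroup.congr _ _ e he
  -- (4) the generic INJECTIVE additive embedding on `H_{E,n}`
  obtain ⟨w, hw, -⟩ := exists_addMonoidHom_subgroupResKer_injective N P γ hgen' hcont
  -- (5) `𝒦_{E,n} ⊆ ker (res : H¹(H_{E,n}, P) → H¹(N, P))`
  have hker : W.localTowerKer κ E n ≤ subgroupResKer P N := by
    intro c hc
    let j : N →ₜ* Hi :=
      { toFun := fun x ↦ ⟨((x : Hn) : Field.absoluteGaloisGroup E), Subgroup.mem_subgroupOf.mp x.2⟩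
        map_one' := rfl
        map_mul' := fun _ _ ↦ rfl
        continuous_toFun :=
          (continuous_subtype_val.comp continuous_subtype_val).subtype_mk _ }
    have hcomp : (resH1Hom j (AddMonoidHom.id P) (fun _ _ ↦ rfl)).comp
        (Literature.NumberTheory.EllipticCurves.resOfLe P hle) = resSubgroup N P := by
      unfold Literature.NumberTheory.EllipticCurves.resOfLe ResKernel.resSubgroup
      rw [resH1Hom_comp]
      exact resH1Hom_congr (ContinuousMonoidHom.ext fun _ ↦ rfl) (AddMonoidHom.ext fun _ ↦ rfl) _ _
    rw [mem_subgroupResKer_iff, ← hcomp, AddMonoidHom.comp_apply,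
      (W.mem_localTowerKer_iff κ E n c).mp hc, map_zero]
  -- (6) the map `𝒦_{E,n}[p^∞][m] → (M_∞/(g-1)M_∞)[m]`, `c ↦ eq (w c)`, and its injectivity
  let ι : W.localTowerKerPrimary κ E n →+ subgroupResKer P N :=
    { toFun := fun c ↦ ⟨(c : discreteH1 Hn P), hker c.2.1⟩
      map_zero' := rfl
      map_add' := fun _ _ ↦ rfl }
  have hι : Function.Injective ι := fun a b hab ↦ by
    have h1 := congrArg (fun z : subgroupResKer P N ↦ (z : discreteH1 Hn P)) hab
    exact Subtype.ext h1
  let F : W.localTowerKerPrimary κ E n →+ FixedPoints.addSubgroup Hi P ⧸ (subOne Hi P g).range :=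
    (eq.toAddMonoidHom.comp w).comp ι
  have hF : Function.Injective F := eq.injective.comp (hw.comp hι)
  let f : {x : W.localTowerKerPrimary κ E n // m • x = 0} →
      {y : FixedPoints.addSubgroup Hi P ⧸ (subOne Hi P g).range // m • y = 0} :=
    fun x ↦ ⟨F x.1, by rw [← map_nsmul, x.2, map_zero]⟩
  have hf : Function.Injective f := fun a b hab ↦
    Subtype.ext (hF (Subtype.ext_iff.mp hab))
  exact ⟨Finite.of_injective f hf, Nat.card_le_card_of_injective f hf⟩

end Summit.BirchSwinnertonDyer.BirchSwinnertonDyer.Theorems.MultTowerNS2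

end
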